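import Summits.CriticalPhenomena.Ising3DConformalLimit.Theses.ModularBoosts

/-!
# CriticalPhenomena / Ising3DConformalLimit — route ModularBoosts, assembly

Settles item `stmt-CriticalPhenomena-5435` (rank 1, assembly of route
`route-CriticalPhenomena-ModularBoosts`):

`IsingLimitLightCone → ModularBoostIsotropy → EllipsoidToSphere → IsingLimitAxisPermutation →
ExistsScaleCovariantLimit → InversionUpgradeNormalised → IsingEuclidUpgradeR4NonGaussian →
Ising3DConformalLimit`.

Pure logic over the summit's structure predicates
(`Literature/Probability/LatticeModels/ConformalCovariance.lean`,
`Literature/Probability/LatticeModels/ScalingLimit3D.lean`): take `ρ, Δ, S` from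
(C) `ExistsScaleCovariantLimit`; (L) `IsingLimitLightCone` gives one speed `v > 0` with causal
slit-gluing (a) and the spectral cone (b); (M) `ModularBoostIsotropy` gives `c > 0` and invariance
of every `S n` under the linear maps preserving `x₀² + x₁² + c² x₂²`; (B₃)
`IsingLimitAxisPermutation` gives invariance under the axis swap `x₀ ↔ x₂`; (V) `EllipsoidToSphere`
(with `Δ > 0` from (C)) gives `IsRotationInvariant S`, hence
`IsEuclideanInvariant S := ⟨transl, rot⟩`; (D) `InversionUpgradeNormalised` gives
`IsInversionCovariant Δ S`; `IsMoebiusCovariant Δ S := ⟨Euclid, scale, inversion⟩` by definition;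
(E) `IsingEuclidUpgradeR4NonGaussian` gives `HasNontrivialU4 S`; conclude
`CritIsing3DConformalLimit` (= `Ising3DConformalLimit`).
No named facts are used; the theorem is unconditional bookkeeping (the same term as the route's
deciding theorem `closes`).
-/

namespace Summit.CriticalPhenomena.Ising3DConformalLimit.Theorems

open Summit.CriticalPhenomena.Ising3DConformalLimit.Theses.ModularBoosts
open Literature.Probability.LatticeModels

/-- Settles `stmt-CriticalPhenomena-5435` (exact signature): the assembly
`IsingLimitLightCone → ModularBoostIsotropy → EllipsoidToSphere → IsingLimitAxisPermutation →
ExistsScaleCovariantLimit → InversionUpgradeNormalised → IsingEuclidUpgradeR4NonGaussian →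
Ising3DConformalLimit` of route ModularBoosts.
Proof: `ρ, Δ, S` from (C); (L) ⇒ a speed `v` with (a), (b); (M) ⇒ `c > 0` and
`Q_c`-isotropy of all `S n`; (B₃) ⇒ the swap `x₀ ↔ x₂`; (V) ⇒ `IsRotationInvariant S`;
Euclidean := ⟨transl, rot⟩; (D) ⇒ inversion covariance; Möbius := ⟨Euclid, scale, inversion⟩
(definition of `IsMoebiusCovariant`, Di Francesco–Mathieu–Sénéchal 1997 §4.3.1); (E) ⇒ `U₄ ≢ 0`.
[folklore] -/
theorem modularBoosts_assembly_proof :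
    Summit.CriticalPhenomena.Ising3DConformalLimit.Theses.ModularBoosts.Assembly := by
  unfold Assembly
  intro hL hM hV hB hC hD hE
  -- (C): a normalised, non-degenerate, translation-invariant, scale-covariant limit with Δ > 0
  obtain ⟨ρ, Δ, S, hρ, hΔ, hlim, hnorm, hnd, htr, hsc⟩ := hC
  -- (L): one speed v with causal slit-gluing (a) and the spectral cone (b)
  obtain ⟨v, hv, ha, hb⟩ := hL ρ Δ S hρ hlim hnorm hnd htr hsc
  -- (M): ellipsoidal isotropy for some c > 0
  obtain ⟨c, hc, hiso⟩ := hM ρ Δ v S hρ hlim hnorm hnd htr hsc hv ha hb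
  -- (B₃): the axis swap x₀ ↔ x₂ passes to the limit
  have hswap := hB ρ S hρ hlim hnorm (Equiv.swap (0 : Fin 3) 2)
  -- (V): ellipsoid + swap + scale covariance + positivity ⇒ O(3)
  have hrot : IsRotationInvariant S := hV Δ c S hΔ hc hnd hsc hswap hiso
  have heuc : IsEuclideanInvariant S := ⟨htr, hrot⟩
  -- (D): inversion upgrade with the same Δ
  have hinv : IsInversionCovariant Δ S := hD ρ Δ S hρ hlim hnorm hnd heuc hsc
  -- (E): U₄ ≢ 0
  have hU4 : HasNontrivialU4 S := hE ρ S hρ hlim hnd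
  exact ⟨ρ, Δ, S, hρ, hΔ, hlim, hnd, ⟨heuc, hsc, hinv⟩, hU4⟩

end Summit.CriticalPhenomena.Ising3DConformalLimit.Theorems
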